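import Summits.SmoothPoincare4.SmoothPoincare4.Theses.EntropyRung
import HarnessLib

/-!
# Cone capping (stub K of line `fat-conical-core-avr-logsobolev`, crux `EntropyRung.SubcylindricalExistence`):
chart-annulus plumbing

Elementary facts about chart annuli `{x ∈ φ.source | a < ρ(x) < b}` (`ρ(x) = ‖φ x − φ p‖`,
`φ = extChartAt p`) used by the assembly of `stub_coneCapping`: openness, measurability, the radial
weight `ϖ = 𝟙 · ρ⁻¹`, closedness of the core region, and the registered index bookkeeping
`helper_coneCapping_zoneAdjacency` (a transition zone of the cut-off family meets only the two pieces
adjacent to it).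
-/

noncomputable section

open scoped Manifold ContDiff Topology
set_option linter.dupNamespace false
open Set Filter MeasureTheory

namespace Summit.SmoothPoincare4.SmoothPoincare4.Theorems

namespace ConeCappingChart

variable {M : Type} [TopologicalSpace M] [ChartedSpace (EuclideanSpace ℝ (Fin 4)) M]

/-- The chart radius `ρ(x) = ‖φ x − φ p‖` is continuous on the chart source. -/
theorem continuousOn_rad (p : M) :
    ContinuousOn (fun x ↦ ‖extChartAt (𝓡 4) p x - extChartAt (𝓡 4) p p‖)
      (extChartAt (𝓡 4) p).source :=
  ((continuousOn_extChartAt p).sub continuousOn_const).norm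

/-- An open chart annulus `{x ∈ source | a < ρ < b}` is open. -/
theorem isOpen_annulus (p : M) (a b : ℝ) :
    IsOpen {x | x ∈ (extChartAt (𝓡 4) p).source ∧ a < ‖extChartAt (𝓡 4) p x - extChartAt (𝓡 4) p p‖ ∧
      ‖extChartAt (𝓡 4) p x - extChartAt (𝓡 4) p p‖ < b} := by
  have h : {x | x ∈ (extChartAt (𝓡 4) p).source ∧ a < ‖extChartAt (𝓡 4) p x - extChartAt (𝓡 4) p p‖ ∧
      ‖extChartAt (𝓡 4) p x - extChartAt (𝓡 4) p p‖ < b} =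
      (extChartAt (𝓡 4) p).source ∩ (fun x ↦ ‖extChartAt (𝓡 4) p x - extChartAt (𝓡 4) p p‖) ⁻¹' (Ioo a b) := by
    ext x; simp only [mem_setOf_eq, mem_inter_iff, mem_preimage, mem_Ioo]
  rw [h]
  exact (continuousOn_rad p).isOpen_inter_preimage (isOpen_extChartAt_source p) isOpen_Ioo

/-- A chart ball `{x ∈ source | ρ < t}` is open. -/
theorem isOpen_ball (p : M) (t : ℝ) :
    IsOpen {x | x ∈ (extChartAt (𝓡 4) p).source ∧ ‖extChartAt (𝓡 4) p x - extChartAt (𝓡 4) p p‖ < t} := by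
  have h : {x | x ∈ (extChartAt (𝓡 4) p).source ∧ ‖extChartAt (𝓡 4) p x - extChartAt (𝓡 4) p p‖ < t} =
      (extChartAt (𝓡 4) p).source ∩ (fun x ↦ ‖extChartAt (𝓡 4) p x - extChartAt (𝓡 4) p p‖) ⁻¹' (Iio t) := by
    ext x; simp only [mem_setOf_eq, mem_inter_iff, mem_preimage, mem_Iio]
  rw [h]
  exact (continuousOn_rad p).isOpen_inter_preimage (isOpen_extChartAt_source p) isOpen_Iio

/-- The core region `{x | x ∈ source → t ≤ ρ(x)}` is closed (its complement is a chart ball). -/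
theorem isClosed_core (p : M) (t : ℝ) :
    IsClosed {x | x ∈ (extChartAt (𝓡 4) p).source → t ≤ ‖extChartAt (𝓡 4) p x - extChartAt (𝓡 4) p p‖} := by
  rw [← isOpen_compl_iff]
  convert isOpen_ball p t using 1
  ext x
  simp only [mem_compl_iff, mem_setOf_eq, Classical.not_imp, not_le]

variable [MeasurableSpace M] [BorelSpace M]

/-- A closed-condition chart annulus `{x ∈ source | a ≤ ρ ≤ b}` is measurable. -/
theorem measurableSet_annulus_closed (p : M) (a b : ℝ) :
    MeasurableSet {x | x ∈ (extChartAt (𝓡 4) p).source ∧ a ≤ ‖extChartAt (𝓡 4) p x - extChartAt (𝓡 4) p p‖ ∧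
      ‖extChartAt (𝓡 4) p x - extChartAt (𝓡 4) p p‖ ≤ b} := by
  have h : {x | x ∈ (extChartAt (𝓡 4) p).source ∧ a ≤ ‖extChartAt (𝓡 4) p x - extChartAt (𝓡 4) p p‖ ∧
      ‖extChartAt (𝓡 4) p x - extChartAt (𝓡 4) p p‖ ≤ b} =
      (extChartAt (𝓡 4) p).source \ ((extChartAt (𝓡 4) p).source ∩
        (fun x ↦ ‖extChartAt (𝓡 4) p x - extChartAt (𝓡 4) p p‖) ⁻¹' (Icc a b)ᶜ) := by
    ext x
    simp only [mem_setOf_eq, Set.mem_sdiff, mem_inter_iff, mem_preimage, mem_compl_iff, mem_Icc]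
    tauto
  rw [h]
  exact (isOpen_extChartAt_source p).measurableSet.diff
    ((continuousOn_rad p).isOpen_inter_preimage (isOpen_extChartAt_source p)
      isClosed_Icc.isOpen_compl).measurableSet

omit [MeasurableSpace M] [BorelSpace M] in
/-- The radial weight `ϖ = 𝟙_{a<ρ<b} ρ⁻¹` is nonnegative. -/
theorem varpi_nonneg (p : M) (a b : ℝ) (x : M) :
    0 ≤ {x | x ∈ (extChartAt (𝓡 4) p).source ∧ a < ‖extChartAt (𝓡 4) p x - extChartAt (𝓡 4) p p‖ ∧
      ‖extChartAt (𝓡 4) p x - extChartAt (𝓡 4) p p‖ < b}.indicator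
        (fun x ↦ ‖extChartAt (𝓡 4) p x - extChartAt (𝓡 4) p p‖⁻¹) x :=
  Set.indicator_nonneg (fun _ _ ↦ inv_nonneg.2 (norm_nonneg _)) x

omit [MeasurableSpace M] [BorelSpace M] in
/-- On the punctured region, `ϖ = ρ⁻¹`. -/
theorem varpi_eq_of_mem (p : M) {a b : ℝ} {x : M} (hx : x ∈ (extChartAt (𝓡 4) p).source)
    (ha : a < ‖extChartAt (𝓡 4) p x - extChartAt (𝓡 4) p p‖)
    (hb : ‖extChartAt (𝓡 4) p x - extChartAt (𝓡 4) p p‖ < b) :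
    {x | x ∈ (extChartAt (𝓡 4) p).source ∧ a < ‖extChartAt (𝓡 4) p x - extChartAt (𝓡 4) p p‖ ∧
      ‖extChartAt (𝓡 4) p x - extChartAt (𝓡 4) p p‖ < b}.indicator
        (fun x ↦ ‖extChartAt (𝓡 4) p x - extChartAt (𝓡 4) p p‖⁻¹) x =
      ‖extChartAt (𝓡 4) p x - extChartAt (𝓡 4) p p‖⁻¹ := by
  rw [Set.indicator_of_mem]
  exact ⟨hx, ha, hb⟩

/-- `ϖ` is measurable when `0 ≤ a` (then `ρ⁻¹` is continuous on the punctured region). -/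
theorem measurable_varpi (p : M) {a b : ℝ} (ha : 0 ≤ a) :
    Measurable ({x | x ∈ (extChartAt (𝓡 4) p).source ∧ a < ‖extChartAt (𝓡 4) p x - extChartAt (𝓡 4) p p‖ ∧
      ‖extChartAt (𝓡 4) p x - extChartAt (𝓡 4) p p‖ < b}.indicator
        (fun x ↦ ‖extChartAt (𝓡 4) p x - extChartAt (𝓡 4) p p‖⁻¹)) := by
  classical
  set U : Set M := {x | x ∈ (extChartAt (𝓡 4) p).source ∧
    a < ‖extChartAt (𝓡 4) p x - extChartAt (𝓡 4) p p‖ ∧ ‖extChartAt (𝓡 4) p x - extChartAt (𝓡 4) p p‖ < b}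
    with hU
  have hUo : IsOpen U := isOpen_annulus p a b
  have hcont : ContinuousOn (fun x ↦ ‖extChartAt (𝓡 4) p x - extChartAt (𝓡 4) p p‖⁻¹) U := by
    refine ((continuousOn_rad p).mono fun x hx ↦ hx.1).inv₀ fun x hx ↦ ?_
    exact (ha.trans_lt hx.2.1).ne'
  have h := hcont.measurable_piecewise (g := fun _ ↦ (0 : ℝ)) continuousOn_const hUo.measurableSet
  have heq : U.indicator (fun x ↦ ‖extChartAt (𝓡 4) p x - extChartAt (𝓡 4) p p‖⁻¹) =
      U.piecewise (fun x ↦ ‖extChartAt (𝓡 4) p x - extChartAt (𝓡 4) p p‖⁻¹) (fun _ ↦ (0 : ℝ)) := by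
    funext x
    by_cases hx : x ∈ U
    · rw [Set.indicator_of_mem hx, Set.piecewise_eq_of_mem _ _ _ hx]
    · rw [Set.indicator_of_notMem hx, Set.piecewise_eq_of_notMem _ _ _ hx]
  rw [heq]
  exact h

/-- Index arithmetic on the exponential grid: `exp (T₀ + u ℓ₀) < exp (T₀ + v ℓ₀)` forces `u < v`. -/
theorem lt_of_exp_grid_lt {T₀ ℓ₀ u v : ℝ} (hℓ : 0 < ℓ₀)
    (h : Real.exp (T₀ + u * ℓ₀) < Real.exp (T₀ + v * ℓ₀)) : u < v := by
  have h1 := Real.exp_lt_exp.1 h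
  nlinarith

end ConeCappingChart

/-- Registered index bookkeeping of the capping's cut-off family (line `fat-conical-core-avr-logsobolev`,
stub K): on the grid `ρ_k = exp (T₀ + k ℓ₀)`, a point of the transition zone
`[ρ_i, ρ_i e^{ℓ₀}] = [ρ_i, ρ_{i+1}]` (`i < N`) can only carry the pieces `j = i` and `j = i + 1`, given the
support windows of the cap piece (`ρ < ρ_1`), the annulus pieces (`ρ_{j−1} < ρ < ρ_{j+1}`) and the core
piece (`ρ > ρ_{N−1}`). -/
theorem helper_coneCapping_zoneAdjacency :
    ∀ (T₀ ℓ₀ ρ : ℝ) (N i j : ℕ), 0 < ℓ₀ → i < N → j ≤ N →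
      Real.exp (T₀ + i * ℓ₀) ≤ ρ → ρ ≤ Real.exp (T₀ + i * ℓ₀ + ℓ₀) →
      (j = 0 → ρ < Real.exp (T₀ + ℓ₀)) →
      (0 < j → j < N → Real.exp (T₀ + ((j : ℝ) - 1) * ℓ₀) < ρ ∧ ρ < Real.exp (T₀ + j * ℓ₀ + ℓ₀)) →
      (j = N → Real.exp (T₀ + ((N : ℝ) - 1) * ℓ₀) < ρ) →
      j = i ∨ j = i + 1 := by
  intro T₀ ℓ₀ ρ N i j hℓ hi hj hlo hhi h0 hmid hN
  have hhi' : ρ ≤ Real.exp (T₀ + ((i : ℝ) + 1) * ℓ₀) := by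
    rw [show T₀ + ((i : ℝ) + 1) * ℓ₀ = T₀ + i * ℓ₀ + ℓ₀ by ring]; exact hhi
  rcases Nat.eq_zero_or_pos j with rfl | hjpos
  · -- cap piece: `ρ < ρ_1` forces `i = 0`
    have h := h0 rfl
    have h1 : (i : ℝ) < 1 := ConeCappingChart.lt_of_exp_grid_lt hℓ
      (by rw [one_mul]; exact hlo.trans_lt h)
    have : i < 1 := by exact_mod_cast h1
    omega
  rcases lt_or_eq_of_le hj with hjN | rfl
  · -- annulus piece
    obtain ⟨ha, hb⟩ := hmid hjpos hjN
    have h1 : (j : ℝ) - 1 < (i : ℝ) + 1 := ConeCappingChart.lt_of_exp_grid_lt hℓ (ha.trans_le hhi')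
    have h2 : (i : ℝ) < (j : ℝ) + 1 := ConeCappingChart.lt_of_exp_grid_lt hℓ
      (by rw [show T₀ + ((j : ℝ) + 1) * ℓ₀ = T₀ + j * ℓ₀ + ℓ₀ by ring]; exact hlo.trans_lt hb)
    have h1' : j < i + 2 := by
      have : (j : ℝ) < (i : ℝ) + 2 := by linarith
      exact_mod_cast this
    have h2' : i < j + 1 := by exact_mod_cast h2
    omega
  · -- core piece
    have h := hN rfl
    have h1 : (j : ℝ) - 1 < (i : ℝ) + 1 := ConeCappingChart.lt_of_exp_grid_lt hℓ (h.trans_le hhi')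
    have h1' : j < i + 2 := by
      have : (j : ℝ) < (i : ℝ) + 2 := by linarith
      exact_mod_cast this
    omega

end Summit.SmoothPoincare4.SmoothPoincare4.Theorems

end
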